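import Summits.QuantumAdvantage.QuantumAdvantage.Theorems.CharDialPlaneDivAscentF2
import HarnessLib

/-!
# PlaneDivAscent — PART F3: the GENERAL BLOCK FAMILY — no codimension constant uniform in `p`
(cell decomp-qadv, lens 6 «barrier-complement carving», g21 REV4; tree-ready, Prop-definition-free; needs Part F2
(`iota`, `iota_cases`, `baseA`, `mem_baseA`), through it Part F1 (`dvd_card_affine_preimage`),
Part D2 (`law_iff_top`) and Part A (`planeCount`, `perIn`).)

For `k ≥ 1` and a prime `p ≥ 2k + 1` the BLOCK SET `SB p k = {y ∈ 𝔽_p^{k+1} : ∃ i < k, y_k = 2i + ι(y_i)}`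
(`ι c = [c ≠ 0]`; `k` pairwise disjoint 2-form cylinders on the slab pairs `y_k ∈ {2i, 2i+1}`, the label `2k`
empty) has all parametrised plane counts `≡ 0 (mod p)` (`planeCount_SB_dvd`: block by block an affine `2 × 2`
preimage of the `p`-point base graph) and no nonzero period (`not_period_SB`: a horizontal period would be a period
of one block's base graph; a vertical one would translate the proper label set `{0, …, 2k-1} ⊊ ℤ/p` into itself).
★ `exists_planeDiv_periodless`, ★★ `not_law K (hK : 1 ≤ K) (hp : 2K + 1 ≤ p)`: the cylinder law with constant
`K` fails at every prime `p ≥ 2K + 1` — `K_field(p) ≥ (p+1)/2`, so the finite-field core of the second structure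
law admits NO constant uniform in `p` (only per-prime finiteness can hold); `k = 3` recovers Part F2.
-/

set_option autoImplicit false

namespace Summit.QuantumAdvantage.AdviceFreeQNC0.PlaneDiv

open Finset Module

variable {p : ℕ} [Fact p.Prime]

/-! ### The GENERAL block family: `k` blocks in `𝔽_p^{k+1}` for `2k + 1 ≤ p`
Block `i < k` is `{y : y_k = 2i + ι(y_i)}` (last coordinate `y_k`), i.e. the 2-form cylinder over `(y_k, y_i)`
with base graph `{(ι c, c)}` sitting on the slab pair `y_k ∈ {2i, 2i+1}`; the labels `0, …, 2k-1` are pairwise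
distinct and the label `2k` is empty because `2k + 1 ≤ p`.  Consequence: `¬ TopRigid p (k+1)` whenever
`1 ≤ k` and `2k + 1 ≤ p`, hence NO codimension constant uniform in `p`. -/

section GenBlock

/-- cast injectivity below `p` -/
theorem natCast_inj_of_lt {a b : ℕ} (ha : a < p) (hb : b < p) (h : (a : ZMod p) = (b : ZMod p)) :
    a = b := by
  have := (ZMod.natCast_eq_natCast_iff' a b p).mp h
  rwa [Nat.mod_eq_of_lt ha, Nat.mod_eq_of_lt hb] at this

/-- `ι c` is the cast of a natural number `≤ 1`. -/
theorem iota_natCast (c : ZMod p) : ∃ e : ℕ, e ≤ 1 ∧ iota c = (e : ZMod p) := by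
  rcases iota_cases c with h | h
  · exact ⟨0, by omega, by rw [h]; simp⟩
  · exact ⟨1, le_rfl, by rw [h]; simp⟩

/-- DISTINCT LABELS: `2i + u = 2i' + u'` with `i, i' < k`, `u, u' ∈ {0,1}` and `2k + 1 ≤ p` forces `i = i'`. -/
theorem label_unique {k : ℕ} (hk : 2 * k + 1 ≤ p) {i i' : Fin k} {u u' : ZMod p}
    (hu : u = 0 ∨ u = 1) (hu' : u' = 0 ∨ u' = 1)
    (h : 2 * ((i : ℕ) : ZMod p) + u = 2 * ((i' : ℕ) : ZMod p) + u') : i = i' := by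
  have hi := i.isLt
  have hi' := i'.isLt
  obtain ⟨e, he, rfl⟩ : ∃ e : ℕ, e ≤ 1 ∧ u = (e : ZMod p) := by
    rcases hu with rfl | rfl
    · exact ⟨0, by omega, by simp⟩
    · exact ⟨1, le_rfl, by simp⟩
  obtain ⟨e', he', rfl⟩ : ∃ e' : ℕ, e' ≤ 1 ∧ u' = (e' : ZMod p) := by
    rcases hu' with rfl | rfl
    · exact ⟨0, by omega, by simp⟩
    · exact ⟨1, le_rfl, by simp⟩
  have hc : ((2 * (i : ℕ) + e : ℕ) : ZMod p) = ((2 * (i' : ℕ) + e' : ℕ) : ZMod p) := by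
    push_cast; exact h
  have := natCast_inj_of_lt (p := p) (by omega) (by omega) hc
  exact Fin.ext (by omega)

open Classical in
/-- THE GENERAL BLOCK SET `SB p k ⊆ 𝔽_p^{k+1}`: `y ∈ SB ⟺ ∃ i < k, y_k = 2i + ι(y_i)`. -/
noncomputable def SB (p : ℕ) [Fact p.Prime] (k : ℕ) : Finset (Fin (k + 1) → ZMod p) :=
  Finset.univ.filter fun y => ∃ i : Fin k, y (Fin.last k) = 2 * ((i : ℕ) : ZMod p) + iota (y i.castSucc)

/-- Membership in the general block set. -/
theorem mem_SB {k : ℕ} {y : Fin (k + 1) → ZMod p} :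
    y ∈ SB p k ↔ ∃ i : Fin k, y (Fin.last k) = 2 * ((i : ℕ) : ZMod p) + iota (y i.castSucc) := by
  classical
  unfold SB
  rw [Finset.mem_filter]
  simp

/-- A point lies in at most one block. -/
theorem block_unique {k : ℕ} (hk : 2 * k + 1 ≤ p) {y : Fin (k + 1) → ZMod p} {i i' : Fin k}
    (h : y (Fin.last k) = 2 * ((i : ℕ) : ZMod p) + iota (y i.castSucc))
    (h' : y (Fin.last k) = 2 * ((i' : ℕ) : ZMod p) + iota (y i'.castSucc)) : i = i' :=
  label_unique hk (iota_cases _) (iota_cases _) (h.symm.trans h')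

/-- PLANE COUNTS OF THE BLOCK SET decompose as the sum of the `k` block counts, each an affine `2 × 2`
preimage count of the base graph. -/
theorem planeCount_SB {k : ℕ} (hk : 2 * k + 1 ≤ p) (x a b : Fin (k + 1) → ZMod p) :
    planeCount (SB p k) x a b = ∑ i : Fin k, (Finset.univ.filter fun st : ZMod p × ZMod p =>
      (x (Fin.last k) - 2 * ((i : ℕ) : ZMod p) + st.1 * a (Fin.last k) + st.2 * b (Fin.last k),
        x i.castSucc + st.1 * a i.castSucc + st.2 * b i.castSucc) ∈ baseA p).card := by
  classical
  unfold planeCount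
  simp_rw [Finset.card_filter]
  rw [Finset.sum_comm]
  refine Finset.sum_congr rfl fun st _ => ?_
  have e : ∀ j, (x + st.1 • a + st.2 • b) j = x j + st.1 * a j + st.2 * b j := fun j => by simp
  have key : ∀ i : Fin k,
      ((x (Fin.last k) - 2 * ((i : ℕ) : ZMod p) + st.1 * a (Fin.last k) + st.2 * b (Fin.last k),
        x i.castSucc + st.1 * a i.castSucc + st.2 * b i.castSucc) ∈ baseA p) ↔
      ((x + st.1 • a + st.2 • b) (Fin.last k) =
        2 * ((i : ℕ) : ZMod p) + iota ((x + st.1 • a + st.2 • b) i.castSucc)) := by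
    intro i
    rw [mem_baseA, e, e]
    constructor
    · intro h; linear_combination h
    · intro h; linear_combination h
  by_cases hmem : x + st.1 • a + st.2 • b ∈ SB p k
  · rw [if_pos hmem]
    obtain ⟨i, hi⟩ := mem_SB.mp hmem
    rw [Finset.sum_eq_single i]
    · rw [if_pos ((key i).mpr hi)]
    · intro i' _ hne
      rw [if_neg]
      intro h'
      exact hne (block_unique hk ((key i').mp h') hi)
    · intro h; exact absurd (Finset.mem_univ i) h
  · rw [if_neg hmem]
    symm
    apply Finset.sum_eq_zero
    intro i _
    rw [if_neg]
    intro h'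
    exact hmem (mem_SB.mpr ⟨i, (key i).mp h'⟩)

/-- THE GENERAL BLOCK SET IS PLANE-DIVISIBLE (`2k + 1 ≤ p`). -/
theorem planeCount_SB_dvd {k : ℕ} (hk : 2 * k + 1 ≤ p) (x a b : Fin (k + 1) → ZMod p) :
    p ∣ planeCount (SB p k) x a b := by
  have hA : p ∣ (baseA p).card := by rw [card_baseA]
  rw [planeCount_SB hk]
  exact Finset.dvd_sum fun i _ => dvd_card_affine_preimage _ hA _ _ _ _ _ _

/-- Every point of the block set has last coordinate among the labels `0, …, 2k - 1`. -/
theorem last_mem_labels {k : ℕ} {y : Fin (k + 1) → ZMod p} (hy : y ∈ SB p k) :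
    ∃ j : ℕ, j < 2 * k ∧ y (Fin.last k) = (j : ZMod p) := by
  obtain ⟨i, hi⟩ := mem_SB.mp hy
  obtain ⟨e, he, hee⟩ := iota_natCast (y i.castSucc)
  have := i.isLt
  exact ⟨2 * i + e, by omega, by rw [hi, hee]; push_cast; ring⟩

/-- Every label `j < 2k` is attained by a point of the block set. -/
theorem exists_mem_last {k : ℕ} (j : ℕ) (hj : j < 2 * k) :
    ∃ y ∈ SB p k, y (Fin.last k) = (j : ZMod p) := by
  have hi : j / 2 < k := by omega
  have hne : (⟨j / 2, hi⟩ : Fin k).castSucc ≠ Fin.last k := ne_of_lt (Fin.castSucc_lt_last _)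
  set y : Fin (k + 1) → ZMod p := fun t => if t = Fin.last k then (j : ZMod p)
      else if t = (⟨j / 2, hi⟩ : Fin k).castSucc then ((j % 2 : ℕ) : ZMod p) else 0 with hy
  have y_last : y (Fin.last k) = (j : ZMod p) := by simp [hy]
  have y_i : y ((⟨j / 2, hi⟩ : Fin k).castSucc) = ((j % 2 : ℕ) : ZMod p) := by
    show (if (⟨j / 2, hi⟩ : Fin k).castSucc = Fin.last k then (j : ZMod p)
      else if (⟨j / 2, hi⟩ : Fin k).castSucc = (⟨j / 2, hi⟩ : Fin k).castSucc
        then ((j % 2 : ℕ) : ZMod p) else 0) = _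
    rw [if_neg hne, if_pos rfl]
  refine ⟨y, ?_, y_last⟩
  rw [mem_SB]
  refine ⟨⟨j / 2, hi⟩, ?_⟩
  have hsplit : (j : ZMod p) = 2 * ((j / 2 : ℕ) : ZMod p) + ((j % 2 : ℕ) : ZMod p) := by
    have h := (Nat.div_add_mod j 2)
    have : ((2 * (j / 2) + j % 2 : ℕ) : ZMod p) = (j : ZMod p) := by rw [h]
    rw [← this]; push_cast; ring
  rw [y_last, y_i, hsplit]
  congr 1
  rcases Nat.mod_two_eq_zero_or_one j with h0 | h1
  · rw [h0]; simp
  · rw [h1]; simp [iota]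

/-- LABEL ESCAPE: for `δ ≠ 0` some label `j < 2k` is shifted by `δ` outside the label set
(the label set is a proper subset of `ℤ/p`, `2k < p`, and contains `0` since `k ≥ 1`). -/
theorem exists_label_escape {k : ℕ} (hk1 : 1 ≤ k) (hk : 2 * k + 1 ≤ p) (δ : ZMod p) (hδ : δ ≠ 0) :
    ∃ j : ℕ, j < 2 * k ∧ ∀ j' : ℕ, j' < 2 * k → (j : ZMod p) + δ ≠ (j' : ZMod p) := by
  haveI : NeZero p := ⟨(Fact.out : p.Prime).ne_zero⟩
  by_contra hcon
  push Not at hcon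
  have closure : ∀ n : ℕ, ∃ j' : ℕ, j' < 2 * k ∧ (n : ZMod p) * δ = (j' : ZMod p) := by
    intro n
    induction n with
    | zero => exact ⟨0, by omega, by simp⟩
    | succ n ih =>
      obtain ⟨j', hj', hj'e⟩ := ih
      obtain ⟨j'', hj'', hj''e⟩ := hcon j' hj'
      exact ⟨j'', hj'', by push_cast; rw [add_mul, one_mul, hj'e, hj''e]⟩
  obtain ⟨j', hj', he⟩ := closure ((((2 * k : ℕ) : ZMod p) * δ⁻¹).val)
  rw [ZMod.natCast_zmod_val, inv_mul_cancel_right₀ hδ] at he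
  have := natCast_inj_of_lt (p := p) (by omega) (by omega) he
  omega

/-- THE GENERAL BLOCK SET HAS NO NONZERO PERIOD (`1 ≤ k`, `2k + 1 ≤ p`). -/
theorem not_period_SB {k : ℕ} (hk1 : 1 ≤ k) (hk : 2 * k + 1 ≤ p) (d : Fin (k + 1) → ZMod p)
    (hd : d ≠ 0) : ¬ ∀ x, x ∈ SB p k ↔ x + d ∈ SB p k := by
  intro hper
  by_cases hδ : d (Fin.last k) = 0
  · have hex : ∃ i : Fin k, d i.castSucc ≠ 0 := by
      by_contra h
      push Not at h
      apply hd
      funext t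
      rcases Fin.eq_castSucc_or_eq_last t with ⟨i, rfl⟩ | rfl
      · exact h i
      · exact hδ
    obtain ⟨i, hi⟩ := hex
    have hne : i.castSucc ≠ Fin.last k := ne_of_lt (Fin.castSucc_lt_last i)
    set x : Fin (k + 1) → ZMod p := fun t => if t = Fin.last k then 2 * ((i : ℕ) : ZMod p) else 0
      with hx
    have hxS : x ∈ SB p k := mem_SB.mpr ⟨i, by simp [hx, hne]⟩
    have hxd : x + d ∈ SB p k := (hper x).mp hxS
    obtain ⟨i', hi'⟩ := mem_SB.mp hxd
    have hne' : i'.castSucc ≠ Fin.last k := ne_of_lt (Fin.castSucc_lt_last i')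
    simp only [Pi.add_apply, hx, if_true, hne', if_false, hδ, add_zero, zero_add] at hi'
    by_cases hii : i' = i
    · subst hii
      rw [iota_of_ne hi] at hi'
      have h10 : (1 : ZMod p) = 0 := by linear_combination -hi'
      exact one_ne_zero h10
    · have h2 : 2 * ((i : ℕ) : ZMod p) + 0 = 2 * ((i' : ℕ) : ZMod p) + iota (d i'.castSucc) := by
        rw [add_zero]; exact hi'
      exact hii (label_unique hk (Or.inl rfl) (iota_cases _) h2).symm
  · obtain ⟨j, hj, hesc⟩ := exists_label_escape hk1 hk (d (Fin.last k)) hδ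
    obtain ⟨y, hyS, hylast⟩ := exists_mem_last (p := p) j hj
    have hyd : y + d ∈ SB p k := (hper y).mp hyS
    obtain ⟨j', hj', hj'e⟩ := last_mem_labels hyd
    rw [Pi.add_apply, hylast] at hj'e
    exact hesc j' hj' hj'e

/-- ★ For every prime `p` and every `k ≥ 1` with `2k + 1 ≤ p` there is a subset of `𝔽_p^{k+1}` all of whose
parametrised plane counts are `≡ 0 (mod p)` and which has NO nonzero period (the block set `SB p k`). -/
theorem exists_planeDiv_periodless {k : ℕ} (hk1 : 1 ≤ k) (hk : 2 * k + 1 ≤ p) :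
    ∃ S : Finset (Fin (k + 1) → ZMod p), (∀ x a b : Fin (k + 1) → ZMod p, p ∣ planeCount S x a b) ∧
      ∀ d : Fin (k + 1) → ZMod p, d ≠ 0 → ¬ ∀ x, x ∈ S ↔ x + d ∈ S :=
  ⟨SB p k, planeCount_SB_dvd hk, not_period_SB hk1 hk⟩

/-- ★★ NO UNIFORM CODIMENSION CONSTANT: for every `K ≥ 1` and every prime `p ≥ 2K + 1` the codimension law
«every plane-divisible `S ⊆ W ≤ 𝔽_pⁿ` is a cylinder over `≤ K` dimensions of `W`» is FALSE at `p` (dimension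
elimination `law_iff_top K` of Part D2 + the block set in `𝔽_p^{K+1}`).  Hence `K_field(p) ≥ (p+1)/2` for every
prime `p ≥ 3` in the language of the second structure law, and no `K` works for all primes; `K = 3`, `p ≥ 7` is
Part F2's `not_law_three`. -/
theorem not_law (K : ℕ) (hK : 1 ≤ K) (hp : 2 * K + 1 ≤ p) :
    ¬ ∀ (n : ℕ) (W : Submodule (ZMod p) (Fin n → ZMod p)) (S : Finset (Fin n → ZMod p)),
        (∀ x ∈ S, x ∈ W) → (∀ x ∈ W, ∀ a ∈ W, ∀ b ∈ W, p ∣ planeCount S x a b) →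
        finrank (ZMod p) W ≤ finrank (ZMod p) (perIn W S) + K := by
  intro h
  obtain ⟨d, hd, hd0⟩ := (law_iff_top K).mp h (SB p K) (planeCount_SB_dvd hp)
  exact not_period_SB hK hp d hd0 (mem_perIn.mp hd).2

end GenBlock

end Summit.QuantumAdvantage.AdviceFreeQNC0.PlaneDiv
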